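import Literature.MathematicalPhysics.QuantumLattice.HubbardNNNHoppingTwistedWindowCertificate
import Literature.MathematicalPhysics.QuantumLattice.TwistedFlipSpaceGroupUnitary
import Literature.MathematicalPhysics.QuantumLattice.InfVolFermionStateSpinFlip
import HarnessLib

/-!
# Variational window certificates with GAUGE-TWISTED symmetry defects INCLUDING THE SPIN EXCHANGE

Twin of `HubbardNNNHoppingVariationalWindowCertificate` (the OP1-E reader of the hubbard-obs one-point
programme: an SOS/symmetry-defect identity in the window algebra, read in the space-group orbit state of an
ARBITRARY unit vector of the torus) for the TWISTED space group `TwistedSpaceGroupUnitary`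
(`T(v, γ, m) = U_v D_γ 𝒢_{j(γ)+2m}`, `𝒢 = e^{iπN̂/2}`): the certificate's symmetry defects may now pair a
lattice element `γ` of `B₁g` sign `−1` with the gauge quarter turn, i.e. they read
`b_l · (φ_l · Γ(incl)(Γ(d4Emb γ_l w_l) W_l) − Γ(incl) W_l)` with `W_l` a ladder word and
`φ_l = gaugePhase (twistExp γ_l m_l) W_l = i^{(j(γ_l)+2m_l)·q(W_l)}` — the dual certificates of eng-2's
TWISTED one-point builds (hubbard-obs PAIRCORR-SDP §13.14 (W8); ×3.8 fewer variables than the readable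
`D₂` export, no transplant). Conclusion unchanged:
`c − Σ_k ‖a_k‖ + Σ_σ μ_σ (Re⟨ζ, N_σ ζ⟩/L² − ν) + κ (u − Re⟨ζ, H^{tt'}_L ζ⟩/L²) ≤ Re ω̄^{tw}_ζ(Γ(ι_{Λ',L}) X)`,
`ω̄^{tw}_ζ = orbitState (twistedSpaceGroupUnitary S) ζ`.

This file is the «D₄ × flip» twin of `HubbardNNNHoppingTwistedWindowCertificate`: averaging family
`twistedFlipSpaceGroupUnitary S` (`T((v,γ),f,m) = U_v D_γ F^f 𝒢_{j(γ)+f+2m}`), ONE flip-symmetric filling row on the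
TOTAL number (`μ₀ (n_{0↑} + n_{0↓} − ν₀·1)`; the flip exchanges `N_↑, N_↓`), and defects
`b_l · (φ_l · Γ(incl)(Γ(d4Emb γ_l w_l)(F^{f_l} W_l)) − Γ(incl) W_l)` with `F^{f} W = spinSwapIter f W` the spin-exchanged word.
* `hubbardTorusTT'_re_orbitState_ge_of_twistedFlip_variational_certificate_ineq` — torus level;
* `re_orbitState_ge_of_twistedFlip_window_variational_certificate_TT'_ineq` — window level (the node shape).

Everything is PROVED from `OrbitStateVariationalCertificate.re_orbitState_ge_of_variational_certificate_ineq`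
(the abstract orbit-state reader) and the closure / commutation facts of `TwistedSpaceGroupUnitary`; no named
fact, no `sorry`. Wang et al. 2024 §III (energy rows), Han 2020 §3 (symmetry rows `F[U⁻¹OU] = F[O]`),
Bratteli–Robinson II §5.2.2 (gauge automorphisms).

References: J. Wang et al., PRX 14 (2024) 031006, §III [WangEtAl2024]; X. Han, arXiv:2006.06002 §3
[Han2020Bootstrap]; O. Bratteli, D. W. Robinson, *Operator Algebras and Quantum Statistical Mechanics 2*,
§5.2.2 [BratteliRobinsonII1997].
-/

noncomputable section

namespace Literature.MathematicalPhysics.QuantumLattice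

open Matrix Finset Complex HubbardWave0 Literature.Probability.LatticeModels
open Literature.MathematicalPhysics.QuantumManyBody.StateRelaxation
open scoped ComplexOrder BigOperators

/-- The `k`-fold spin exchange of a window observable (`k = 0, 1` in the certificates). [cite: Han2020Bootstrap, §3] -/
def spinSwapIter {Λ : Finset (Site 2)} (k : ℕ) (A : FermionOp Λ) : FermionOp Λ :=
  (relabel (Orb.spinSwap : Orb (PolySite Λ) ≃ Orb (PolySite Λ)))^[k] A

/-- `spinSwapIter 0 A = A`. [cite: Han2020Bootstrap, §3] -/
@[simp] theorem spinSwapIter_zero {Λ : Finset (Site 2)} (A : FermionOp Λ) : spinSwapIter 0 A = A := rfl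

/-- `spinSwapIter (k+1) A = relabel spinSwap (spinSwapIter k A)`. [cite: Han2020Bootstrap, §3] -/
theorem spinSwapIter_succ {Λ : Finset (Site 2)} (k : ℕ) (A : FermionOp Λ) :
    spinSwapIter (k + 1) A = relabel (Orb.spinSwap : Orb (PolySite Λ) ≃ Orb (PolySite Λ)) (spinSwapIter k A) := by
  rw [spinSwapIter, spinSwapIter, Function.iterate_succ_apply']

/-! ### Torus level -/

section Torus

variable {L : ℕ} [NeZero L]

/-- (Local to this section.) [folklore] -/
local instance (priority := high) instDecidableEqFermionTorusTwFW : DecidableEq (FermionTorus 2 L) :=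
  LinearOrder.toDecidableEq

/-- **Variational certificate with flip-twisted defects ⇒ flip-twisted-orbit-averaged expectation in EVERY unit
vector of the `t–t'` torus.** As `hubbardTorusTT'_re_orbitState_ge_of_twisted_variational_certificate_ineq` with the
family `twistedFlipSpaceGroupUnitary S` and defects `T_l Y_l T_lᴴ − Y_l`, `T_l = U_{w_l} D_{γ_l} F^{f_l} 𝒢_{j(γ_l)+f_l+2m_l}`
(`γ_l ∈ S`); the density observables `G_i` must commute with the family (e.g. the TOTAL number).
[cite: WangEtAl2024, §III] [cite: Han2020Bootstrap, §3] -/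
theorem hubbardTorusTT'_re_orbitState_ge_of_twistedFlip_variational_certificate_ineq (t t' U : ℝ)
    {S : Finset (DihedralGroup 4)} (h1 : (1 : DihedralGroup 4) ∈ S) (hmul : ∀ a ∈ S, ∀ b ∈ S, a * b ∈ S)
    (K : Submodule ℂ (Fock (Orb (FermionTorus 2 L))))
    (hK : ∀ g : ((TorusSite 2 L × ↥S) × Fin 2) × Fin 2, ∀ φ ∈ K, (twistedFlipSpaceGroupUnitary S g)ᴴ *ᵥ φ ∈ K)
    {ζ : Fock (Orb (FermionTorus 2 L))} (hζK : ζ ∈ K) (hζ1 : star ζ ⬝ᵥ ζ = 1)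
    (X Eloc : Matrix (Finset (Orb (FermionTorus 2 L))) (Finset (Orb (FermionTorus 2 L))) ℂ)
    (hE : ∑ v : TorusSite 2 L, (fockTranslate v).val * Eloc * (fockTranslate v).valᴴ =
      hubbardTorusTT' L t t' U) (κ u : ℝ)
    {δ' : Type*} (dens : Finset δ') (μ ν : δ' → ℝ)
    (D G : δ' → Matrix (Finset (Orb (FermionTorus 2 L))) (Finset (Orb (FermionTorus 2 L))) ℂ)
    (hD : ∀ i ∈ dens, ∑ v : TorusSite 2 L, (fockTranslate v).val * D i * (fockTranslate v).valᴴ = G i)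
    (hG : ∀ i ∈ dens, ∀ g : ((TorusSite 2 L × ↥S) × Fin 2) × Fin 2,
      twistedFlipSpaceGroupUnitary S g * G i = G i * twistedFlipSpaceGroupUnitary S g)
    {m : Type*} [Fintype m] [DecidableEq m] {Λm : Matrix m m ℂ} (hΛ : Λm.PosSemidef)
    (O : m → Matrix (Finset (Orb (FermionTorus 2 L))) (Finset (Orb (FermionTorus 2 L))) ℂ)
    {ι : Type*} (tt : Finset ι) (γ : ι → DihedralGroup 4) (hγS : ∀ l ∈ tt, γ l ∈ S)
    (wv : ι → TorusSite 2 L) (fl mt : ι → Fin 2)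
    (Y : ι → Matrix (Finset (Orb (FermionTorus 2 L))) (Finset (Orb (FermionTorus 2 L))) ℂ)
    {ρ : Type*} (r : Finset ρ)
    (Q Z Z' : ρ → Matrix (Finset (Orb (FermionTorus 2 L))) (Finset (Orb (FermionTorus 2 L))) ℂ)
    (q : ρ → ℝ) (hQh : ∀ i ∈ r, (Q i).IsHermitian)
    (hQ : ∀ i ∈ r, ∀ φ ∈ K, Q i *ᵥ φ = ((q i : ℝ) : ℂ) • φ)
    {γ' : Type*} (u' : Finset γ')
    (C W : γ' → Matrix (Finset (Orb (FermionTorus 2 L))) (Finset (Orb (FermionTorus 2 L))) ℂ)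
    (qc : γ' → ℝ) (hCh : ∀ j ∈ u', (C j).IsHermitian)
    (hC : ∀ j ∈ u', ∀ φ ∈ K, C j *ᵥ φ = ((qc j : ℝ) : ℂ) • φ)
    {δ : Type*} (ah : Finset δ) (dc : δ → ℝ)
    (V : δ → Matrix (Finset (Orb (FermionTorus 2 L))) (Finset (Orb (FermionTorus 2 L))) ℂ)
    {κ'' : Type*} (w : Finset κ'') (a : κ'' → ℂ)
    (M : κ'' → Matrix (Finset (Orb (FermionTorus 2 L))) (Finset (Orb (FermionTorus 2 L))) ℂ)
    (hM : ∀ k ∈ w, (M k).IsContraction) {c : ℝ}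
    (hcert : X - (c : ℂ) • (1 : Matrix (Finset (Orb (FermionTorus 2 L))) (Finset (Orb (FermionTorus 2 L))) ℂ) -
        ∑ i ∈ dens, ((μ i : ℝ) : ℂ) • (D i - ((ν i : ℝ) : ℂ) •
          (1 : Matrix (Finset (Orb (FermionTorus 2 L))) (Finset (Orb (FermionTorus 2 L))) ℂ)) -
        ((κ : ℝ) : ℂ) • (((u : ℝ) : ℂ) •
          (1 : Matrix (Finset (Orb (FermionTorus 2 L))) (Finset (Orb (FermionTorus 2 L))) ℂ) - Eloc) =
      gramForm Λm O +
        (∑ l ∈ tt, ((fockTranslate (wv l)).val * (fockD4 (L := L) (γ l)).val * fockSpinFlip ^ (fl l).val * fockGauge (twistFlipExp (γ l) (fl l) (mt l)) * Y l *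
              ((fockTranslate (wv l)).val * (fockD4 (L := L) (γ l)).val * fockSpinFlip ^ (fl l).val * fockGauge (twistFlipExp (γ l) (fl l) (mt l)))ᴴ - Y l) +
          ∑ i ∈ r, (Z i * (Q i - ((q i : ℝ) : ℂ) • 1) + (Q i - ((q i : ℝ) : ℂ) • 1) * Z' i) +
          ∑ j ∈ u', (C j * W j - W j * C j)) +
        (∑ m' ∈ ah, ((dc m' : ℝ) : ℂ) • ((V m')ᴴ - V m') + ∑ k ∈ w, a k • M k)) :
    c - ∑ k ∈ w, ‖a k‖ +
        ∑ i ∈ dens, μ i * ((star ζ ⬝ᵥ (G i *ᵥ ζ)).re / (L : ℝ) ^ 2 - ν i) +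
        κ * (u - (star ζ ⬝ᵥ (hubbardTorusTT' L t t' U *ᵥ ζ)).re / (L : ℝ) ^ 2) ≤
      (orbitState (twistedFlipSpaceGroupUnitary S) ζ X).re := by
  haveI : Nonempty ↥S := ⟨⟨1, h1⟩⟩
  have hUT : ∀ l ∈ tt, ∃ σ : (((TorusSite 2 L × ↥S) × Fin 2) × Fin 2) ≃ (((TorusSite 2 L × ↥S) × Fin 2) × Fin 2), ∀ g,
      twistedFlipSpaceGroupUnitary S g *
          ((fockTranslate (wv l)).val * (fockD4 (L := L) (γ l)).val * fockSpinFlip ^ (fl l).val * fockGauge (twistFlipExp (γ l) (fl l) (mt l))) =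
        twistedFlipSpaceGroupUnitary S (σ g) := fun l hl =>
    twistedFlipSpaceGroupUnitary_closed (L := L) hmul (wv l) (hγS l hl) (fl l) (mt l)
  have h := re_orbitState_ge_of_variational_certificate_ineq (hubbardTorusTT' L t t' U) K hζK hζ1
    (twistedFlipSpaceGroupUnitary S) (fun g' => twistedFlipSpaceGroupUnitary_mul_hubbardTorusTT' S t t' U g')
    (fun g' => twistedFlipSpaceGroupUnitary_conjTranspose_mul_self S g') hK
    (fun v => (fockTranslate v).val) (fun v => twistedFlipSpaceGroupUnitary_closed_translate h1 hmul v)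
    X Eloc hE κ u dens μ ν D G hD hG hΛ O tt
    (fun l => (fockTranslate (wv l)).val * (fockD4 (L := L) (γ l)).val * fockSpinFlip ^ (fl l).val * fockGauge (twistFlipExp (γ l) (fl l) (mt l))) Y
    hUT r Q Z Z' q hQh hQ u' C W qc hCh hC ah dc V w a M hM hcert
  rw [card_torusSite] at h
  push_cast at h
  exact h

end Torus

/-! ### Window level -/

section Window

variable {L : ℕ} [NeZero L]

/-- (Local to this section.) [folklore] -/
local instance (priority := high) instDecidableEqFermionTorusTwFWin : DecidableEq (FermionTorus 2 L) :=
  LinearOrder.toDecidableEq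

/-- The torus image of the `k`-fold spin-exchanged window observable is the `F^k`-conjugate of its torus image.
[cite: BenfattoGiulianiMastropietro2006, §2.1] -/
theorem fermionEmbed_toTorusEmb_spinSwapIter {Λ : Finset (Site 2)} (h : Set.InjOn (Torus.proj (d := 2) L) ↑Λ)
    (k : ℕ) (A : FermionOp Λ) :
    fermionEmbed (PolySite.toTorusEmb L h) (spinSwapIter k A) =
      fockSpinFlip ^ k * fermionEmbed (PolySite.toTorusEmb L h) A * (fockSpinFlip ^ k)ᴴ := by
  induction k with
  | zero => simp
  | succ k ih =>
    rw [spinSwapIter_succ, fermionEmbed_relabel_spinSwap, relabel_eq_fockRelabel_conj, ← fockSpinFlip_def, ih,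
      pow_succ', conjTranspose_mul]
    simp only [Matrix.mul_assoc]

/-- **Flip-twisted variational window certificate ⇒ flip-twisted-orbit-averaged expectation of a local observable in
EVERY unit vector of every large `t–t'` torus.** Data as in `re_orbitState_ge_of_twisted_window_variational_certificate_TT'_ineq`
except: ONE flip-symmetric filling row `μ₀ • (n_{0↑} + n_{0↓} − ν₀ • 1)` on the total number, and defects
`b_l • (φ_l • Γ(incl)(Γ(d4Emb γ_l w_l)(F^{f_l} W_l)) − Γ(incl) W_l)` with `W_l = ladderWord (yw l)`, `F^{f} W = spinSwapIter f W`,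
`φ_l = gaugePhase (twistFlipExp γ_l f_l m_l) (yw l)`. Conclusion:
`c − Σₖ ‖aₖ‖ + μ₀ (Re⟨ζ, N̂ ζ⟩/L² − ν₀) + κ (u − Re⟨ζ, H^{tt'}_L ζ⟩/L²) ≤ Re ω̄^{tw,F}_ζ(Γ(ι_{Λ',L}) X)`,
`ω̄^{tw,F}_ζ = orbitState (twistedFlipSpaceGroupUnitary S) ζ`. [cite: WangEtAl2024, §III] [cite: Han2020Bootstrap, §3] -/
theorem re_orbitState_ge_of_twistedFlip_window_variational_certificate_TT'_ineq (t t' U : ℝ) (hL : 3 ≤ L)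
    {Λ Λ' : Finset (Site 2)} (hΛ : Λ ⊆ Λ')
    (h0 : thicken ({0} : Finset (Site 2)) 1 ⊆ Λ') (hz : (0 : Site 2) ∈ Λ')
    (hInj' : Set.InjOn (Torus.proj (d := 2) L) ↑Λ')
    {S : Finset (DihedralGroup 4)} (h1 : (1 : DihedralGroup 4) ∈ S) (hmul : ∀ a ∈ S, ∀ b ∈ S, a * b ∈ S)
    {ζ : Fock (Orb (FermionTorus 2 L))} (hζ1 : star ζ ⬝ᵥ ζ = 1)
    (Xw : FermionOp Λ') (κ u μ₀ ν₀ : ℝ)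
    {m : Type*} [Fintype m] [DecidableEq m] {Λm : Matrix m m ℂ} (hΛm : Λm.PosSemidef)
    (O : m → FermionOp Λ')
    {ι : Type*} (tt : Finset ι) (γ : ι → DihedralGroup 4) (hγS : ∀ l ∈ tt, γ l ∈ S) (wv : ι → Site 2)
    (fl mt : ι → Fin 2) (hsh : ∀ l, d4ShiftSet (γ l) (wv l) Λ ⊆ Λ') (b : ι → ℂ)
    (yw : ι → List (Orb (PolySite Λ) × Bool))
    {δ : Type*} (ah : Finset δ) (dc : δ → ℝ) (V : δ → FermionOp Λ')
    {κ'' : Type*} (w : Finset κ'') (a : κ'' → ℂ) (word : κ'' → List (Orb (PolySite Λ') × Bool)) {c : ℝ}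
    (hcert : Xw - (c : ℂ) • (1 : FermionOp Λ') -
        ((μ₀ : ℝ) : ℂ) • (nAt 0 hz 0 + nAt 0 hz 1 - ((ν₀ : ℝ) : ℂ) • (1 : FermionOp Λ')) -
        ((κ : ℝ) : ℂ) • (((u : ℝ) : ℂ) • (1 : FermionOp Λ') -
          fermionEmbed (PolySite.incl h0) ((hubbardTTPrimeFermionInteraction t t' U).meanEnergyObs 1)) =
      gramForm Λm O +
        ∑ l ∈ tt, b l • (gaugePhase (twistFlipExp (γ l) (fl l) (mt l)) (yw l) •
            fermionEmbed (PolySite.incl (hsh l))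
              (fermionEmbed (PolySite.d4Emb (γ l) (wv l) Λ) (spinSwapIter (fl l).val (ladderWord (yw l)))) -
            fermionEmbed (PolySite.incl hΛ) (ladderWord (yw l))) +
        (∑ m' ∈ ah, ((dc m' : ℝ) : ℂ) • ((V m')ᴴ - V m') + ∑ k ∈ w, a k • ladderWord (word k))) :
    c - ∑ k ∈ w, ‖a k‖ +
        μ₀ * ((star ζ ⬝ᵥ ((totalNumber : Matrix (Finset (Orb (FermionTorus 2 L))) _ ℂ) *ᵥ ζ)).re / (L : ℝ) ^ 2 - ν₀) +
        κ * (u - (star ζ ⬝ᵥ (hubbardTorusTT' L t t' U *ᵥ ζ)).re / (L : ℝ) ^ 2) ≤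
      (orbitState (twistedFlipSpaceGroupUnitary S) ζ (fermionEmbed (PolySite.toTorusEmb L hInj') Xw)).re := by
  have hInjΛ : Set.InjOn (Torus.proj (d := 2) L) ↑Λ := hInj'.mono (by exact_mod_cast hΛ)
  have hInj0 : Set.InjOn (Torus.proj (d := 2) L) ↑(thicken ({0} : Finset (Site 2)) 1) :=
    hInj'.mono (by exact_mod_cast h0)
  set Γ' := fermionEmbed (PolySite.toTorusEmb L hInj') with hΓ'
  set ΓΛ := fermionEmbed (PolySite.toTorusEmb L hInjΛ) with hΓΛ
  set H := hubbardTorusTT' L t t' U with hH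
  set EΦ := (hubbardTTPrimeFermionInteraction t t' U).meanEnergyObs 1 with hEΦ
  set X := Γ' (fermionEmbed (PolySite.incl h0) EΦ) with hX
  have hX0 : X = fermionEmbed (PolySite.toTorusEmb L hInj0) EΦ := fermionEmbed_toTorusEmb_incl h0 hInj' EΦ
  have hsum : ∑ v' : TorusSite 2 L, (fockTranslate v').val * X * (fockTranslate v').valᴴ = H := by
    rw [hX0]
    have h := sum_relabel_translate_hubbardTTPrime_meanEnergyObs (L := L) t' t U hL
    simp_rw [relabel_eq_fockRelabel_conj] at h
    exact h
  -- the single (flip-symmetric) density observable `n_{0↑} + n_{0↓}`, whose translates sum to `N̂`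
  set D0 : Matrix (Finset (Orb (FermionTorus 2 L))) (Finset (Orb (FermionTorus 2 L))) ℂ :=
    numberOp (FermionTorus.ofTorusSite (0 : TorusSite 2 L)) 0 + numberOp (FermionTorus.ofTorusSite (0 : TorusSite 2 L)) 1
    with hD0
  set N : Matrix (Finset (Orb (FermionTorus 2 L))) (Finset (Orb (FermionTorus 2 L))) ℂ := totalNumber with hN
  have hDΓ : Γ' (nAt 0 hz 0 + nAt 0 hz 1) = D0 := by
    rw [map_add, fermionEmbed_toTorusEmb_nAt_zero hz hInj', fermionEmbed_toTorusEmb_nAt_zero hz hInj']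
  have hDsum : ∀ i ∈ (Finset.univ : Finset (Fin 1)),
      ∑ v' : TorusSite 2 L, (fockTranslate v').val * D0 * (fockTranslate v').valᴴ = N := by
    intro _ _
    rw [hD0]
    simp_rw [Matrix.mul_add, Matrix.add_mul, Finset.sum_add_distrib, sum_conj_fockTranslate_numberOp (0 : TorusSite 2 L)]
    rw [hN, totalNumber, ← Finset.sum_add_distrib]
    exact Finset.sum_congr rfl fun y _ => (Fin.sum_univ_two _).symm
  have hGT : ∀ i ∈ (Finset.univ : Finset (Fin 1)), ∀ g : ((TorusSite 2 L × ↥S) × Fin 2) × Fin 2,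
      twistedFlipSpaceGroupUnitary S g * N = N * twistedFlipSpaceGroupUnitary S g :=
    fun _ _ g => twistedFlipSpaceGroupUnitary_commute_totalNumber S g
  -- symmetry family: the torus images of the words `W_l`, with their coefficients
  set emb0 : Orb (PolySite Λ) × Bool → Orb (FermionTorus 2 L) × Bool :=
    fun p => (Orb.embMap (PolySite.toTorusEmb L hInjΛ) p.1, p.2) with hemb0
  set Yt : ι → Matrix (Finset (Orb (FermionTorus 2 L))) (Finset (Orb (FermionTorus 2 L))) ℂ :=
    fun l => b l • ΓΛ (ladderWord (yw l)) with hYt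
  have hYtw : ∀ l, ΓΛ (ladderWord (yw l)) = ladderWord ((yw l).map emb0) := fun l => by
    rw [hΓΛ, fermionEmbed_ladderWord]
  -- residual words
  set emb : Orb (PolySite Λ') × Bool → Orb (FermionTorus 2 L) × Bool :=
    fun p => (Orb.embMap (PolySite.toTorusEmb L hInj') p.1, p.2) with hemb
  set M : κ'' → Matrix (Finset (Orb (FermionTorus 2 L))) (Finset (Orb (FermionTorus 2 L))) ℂ :=
    fun k => ladderWord ((word k).map emb) with hM
  have hMc : ∀ k ∈ w, (M k).IsContraction := fun k _ => by
    rw [hM]; dsimp only; rw [ladderWord_eq_prod]; exact isContraction_prod_ladder _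
  -- the left-hand side, pulled back into the torus
  have hlhs : Γ' (Xw - (c : ℂ) • (1 : FermionOp Λ') -
        ((μ₀ : ℝ) : ℂ) • (nAt 0 hz 0 + nAt 0 hz 1 - ((ν₀ : ℝ) : ℂ) • (1 : FermionOp Λ')) -
        ((κ : ℝ) : ℂ) • (((u : ℝ) : ℂ) • (1 : FermionOp Λ') - fermionEmbed (PolySite.incl h0) EΦ)) =
      Γ' Xw - (c : ℂ) • (1 : Matrix (Finset (Orb (FermionTorus 2 L))) (Finset (Orb (FermionTorus 2 L))) ℂ) -
        ∑ i ∈ (Finset.univ : Finset (Fin 1)), (((fun _ => μ₀) i : ℝ) : ℂ) • (D0 - (((fun _ => ν₀) i : ℝ) : ℂ) •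
          (1 : Matrix (Finset (Orb (FermionTorus 2 L))) (Finset (Orb (FermionTorus 2 L))) ℂ)) -
        ((κ : ℝ) : ℂ) • (((u : ℝ) : ℂ) •
          (1 : Matrix (Finset (Orb (FermionTorus 2 L))) (Finset (Orb (FermionTorus 2 L))) ℂ) - X) := by
    have hs : Γ' (((μ₀ : ℝ) : ℂ) • (nAt 0 hz 0 + nAt 0 hz 1 - ((ν₀ : ℝ) : ℂ) • (1 : FermionOp Λ'))) =
        ∑ i ∈ (Finset.univ : Finset (Fin 1)), (((fun _ => μ₀) i : ℝ) : ℂ) • (D0 - (((fun _ => ν₀) i : ℝ) : ℂ) •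
          (1 : Matrix (Finset (Orb (FermionTorus 2 L))) (Finset (Orb (FermionTorus 2 L))) ℂ)) := by
      rw [Finset.sum_const, Finset.card_univ, Fintype.card_fin, one_smul, map_smul, map_sub, map_smul, map_one, hDΓ]
    have hk : Γ' (((κ : ℝ) : ℂ) • (((u : ℝ) : ℂ) • (1 : FermionOp Λ') - fermionEmbed (PolySite.incl h0) EΦ)) =
        ((κ : ℝ) : ℂ) • (((u : ℝ) : ℂ) •
          (1 : Matrix (Finset (Orb (FermionTorus 2 L))) (Finset (Orb (FermionTorus 2 L))) ℂ) - X) := by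
      rw [map_smul, map_sub, map_smul, map_one, hX]
    rw [map_sub, hk, map_sub, hs, map_sub, map_smul, map_one]
  -- the flip-twisted defects, pulled back into the torus
  have h2l : ∀ l ∈ tt, Γ' (b l • (gaugePhase (twistFlipExp (γ l) (fl l) (mt l)) (yw l) •
        fermionEmbed (PolySite.incl (hsh l))
          (fermionEmbed (PolySite.d4Emb (γ l) (wv l) Λ) (spinSwapIter (fl l).val (ladderWord (yw l)))) -
        fermionEmbed (PolySite.incl hΛ) (ladderWord (yw l)))) =
      (fockTranslate (Torus.proj L (wv l))).val * (fockD4 (L := L) (γ l)).val * fockSpinFlip ^ (fl l).val *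
          fockGauge (twistFlipExp (γ l) (fl l) (mt l)) * Yt l *
        ((fockTranslate (Torus.proj L (wv l))).val * (fockD4 (L := L) (γ l)).val * fockSpinFlip ^ (fl l).val *
          fockGauge (twistFlipExp (γ l) (fl l) (mt l)))ᴴ - Yt l := by
    intro l _
    set UD := (fockTranslate (Torus.proj L (wv l))).val * (fockD4 (L := L) (γ l)).val with hUD
    set Fk : Matrix (Finset (Orb (FermionTorus 2 L))) _ ℂ := fockSpinFlip ^ (fl l).val with hFk
    set Ge : Matrix (Finset (Orb (FermionTorus 2 L))) _ ℂ := fockGauge (twistFlipExp (γ l) (fl l) (mt l)) with hGe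
    have hgauge : Ge * Yt l * Geᴴ = gaugePhase (twistFlipExp (γ l) (fl l) (mt l)) (yw l) • Yt l := by
      rw [hYt]; dsimp only
      rw [Matrix.mul_smul, Matrix.smul_mul, hYtw l, hGe, fockGauge_conj_ladderWord, hemb0, gaugePhase_map_fst, smul_comm]
    have hrhs : UD * Fk * Ge * Yt l * (UD * Fk * Ge)ᴴ =
        gaugePhase (twistFlipExp (γ l) (fl l) (mt l)) (yw l) • (UD * (Fk * Yt l * Fkᴴ) * UDᴴ) := by
      rw [conjTranspose_mul, conjTranspose_mul,
        show UD * Fk * Ge * Yt l * (Geᴴ * (Fkᴴ * UDᴴ)) = UD * (Fk * (Ge * Yt l * Geᴴ) * Fkᴴ) * UDᴴ by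
          simp only [Matrix.mul_assoc],
        hgauge, Matrix.mul_smul, Matrix.smul_mul, Matrix.mul_smul, Matrix.smul_mul]
    rw [hrhs, map_smul, map_sub, map_smul, fermionEmbed_toTorusEmb_incl (hsh l) hInj',
      fermionEmbed_toTorusEmb_incl hΛ hInj',
      fermionEmbed_toTorusEmb_d4Emb (γ l) (wv l) hInjΛ (hInj'.mono (by exact_mod_cast (hsh l)))
        (spinSwapIter (fl l).val (ladderWord (yw l))),
      ← d4Affine_conj, fermionEmbed_toTorusEmb_spinSwapIter hInjΛ, hYt]
    dsimp only
    rw [hΓΛ, hUD, hFk]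
    simp only [Matrix.mul_smul, Matrix.smul_mul, smul_sub, Matrix.mul_assoc]
    rw [smul_comm]
  -- the identity, pulled back into the torus (empty sector and charge families)
  have htorus : Γ' Xw - (c : ℂ) • (1 : Matrix (Finset (Orb (FermionTorus 2 L))) (Finset (Orb (FermionTorus 2 L))) ℂ) -
      ∑ i ∈ (Finset.univ : Finset (Fin 1)), (((fun _ => μ₀) i : ℝ) : ℂ) • (D0 - (((fun _ => ν₀) i : ℝ) : ℂ) •
        (1 : Matrix (Finset (Orb (FermionTorus 2 L))) (Finset (Orb (FermionTorus 2 L))) ℂ)) -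
      ((κ : ℝ) : ℂ) • (((u : ℝ) : ℂ) •
        (1 : Matrix (Finset (Orb (FermionTorus 2 L))) (Finset (Orb (FermionTorus 2 L))) ℂ) - X) =
      gramForm Λm (fun i => Γ' (O i)) +
        (∑ l ∈ tt, ((fockTranslate (Torus.proj L (wv l))).val * (fockD4 (L := L) (γ l)).val * fockSpinFlip ^ (fl l).val *
              fockGauge (twistFlipExp (γ l) (fl l) (mt l)) * Yt l *
              ((fockTranslate (Torus.proj L (wv l))).val * (fockD4 (L := L) (γ l)).val * fockSpinFlip ^ (fl l).val *
                fockGauge (twistFlipExp (γ l) (fl l) (mt l)))ᴴ - Yt l) +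
          ∑ i ∈ (∅ : Finset (Fin 0)), ((0 : Matrix _ _ ℂ) * ((0 : Matrix _ _ ℂ) - (((0 : ℝ) : ℝ) : ℂ) • 1) +
            ((0 : Matrix _ _ ℂ) - (((0 : ℝ) : ℝ) : ℂ) • 1) * (0 : Matrix _ _ ℂ)) +
          ∑ j ∈ (∅ : Finset (Fin 0)), ((0 : Matrix _ _ ℂ) * (0 : Matrix _ _ ℂ) - (0 : Matrix _ _ ℂ) * (0 : Matrix _ _ ℂ))) +
        (∑ m' ∈ ah, ((dc m' : ℝ) : ℂ) • ((Γ' (V m'))ᴴ - Γ' (V m')) + ∑ k ∈ w, a k • M k) := by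
    have key := congrArg Γ' hcert
    rw [hlhs] at key
    have h2 : Γ' (∑ l ∈ tt, b l • (gaugePhase (twistFlipExp (γ l) (fl l) (mt l)) (yw l) •
          fermionEmbed (PolySite.incl (hsh l))
            (fermionEmbed (PolySite.d4Emb (γ l) (wv l) Λ) (spinSwapIter (fl l).val (ladderWord (yw l)))) -
          fermionEmbed (PolySite.incl hΛ) (ladderWord (yw l)))) =
        ∑ l ∈ tt, ((fockTranslate (Torus.proj L (wv l))).val * (fockD4 (L := L) (γ l)).val * fockSpinFlip ^ (fl l).val *
              fockGauge (twistFlipExp (γ l) (fl l) (mt l)) * Yt l *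
            ((fockTranslate (Torus.proj L (wv l))).val * (fockD4 (L := L) (γ l)).val * fockSpinFlip ^ (fl l).val *
              fockGauge (twistFlipExp (γ l) (fl l) (mt l)))ᴴ - Yt l) := by
      rw [map_sum]
      exact Finset.sum_congr rfl h2l
    have h4 : Γ' (∑ m' ∈ ah, ((dc m' : ℝ) : ℂ) • ((V m')ᴴ - V m')) =
        ∑ m' ∈ ah, ((dc m' : ℝ) : ℂ) • ((Γ' (V m'))ᴴ - Γ' (V m')) := by
      rw [map_sum]
      refine Finset.sum_congr rfl fun m' _ => ?_
      rw [map_smul, map_sub, hΓ', fermionEmbed_conjTranspose]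
    have h5 : Γ' (∑ k ∈ w, a k • ladderWord (word k)) = ∑ k ∈ w, a k • M k := by
      rw [map_sum]
      refine Finset.sum_congr rfl fun k _ => ?_
      rw [map_smul, hM, hΓ', fermionEmbed_ladderWord]
    rw [key, map_add, map_add, map_add, hΓ', fermionEmbed_gramForm, ← hΓ', h2, h4, h5,
      Finset.sum_empty, Finset.sum_empty, add_zero, add_zero]
  have hmain := hubbardTorusTT'_re_orbitState_ge_of_twistedFlip_variational_certificate_ineq t t' U h1 hmul ⊤
    (fun _ _ _ => Submodule.mem_top) (Submodule.mem_top : ζ ∈ (⊤ : Submodule ℂ _)) hζ1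
    (Γ' Xw) X hsum κ u (Finset.univ : Finset (Fin 1)) (fun _ => μ₀) (fun _ => ν₀) (fun _ => D0) (fun _ => N) hDsum hGT hΛm
    (fun i => Γ' (O i)) tt γ hγS (fun l => Torus.proj L (wv l)) fl mt Yt
    (∅ : Finset (Fin 0)) (fun _ => 0) (fun _ => 0) (fun _ => 0) (fun _ => 0)
    (fun i hi => absurd hi (Finset.notMem_empty i)) (fun i hi => absurd hi (Finset.notMem_empty i))
    (∅ : Finset (Fin 0)) (fun _ => 0) (fun _ => 0) (fun _ => 0)
    (fun i hi => absurd hi (Finset.notMem_empty i)) (fun i hi => absurd hi (Finset.notMem_empty i))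
    ah dc (fun m' => Γ' (V m')) w a M hMc htorus
  rw [Finset.sum_const, Finset.card_univ, Fintype.card_fin, one_smul] at hmain
  exact hmain

end Window

end Literature.MathematicalPhysics.QuantumLattice

end
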